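import Summits.Ventures.YMGap.RobustBall.OneStateLoops
import Summits.Ventures.YMGap.RobustBall.StarRowsSU3PV2T
import Summits.Ventures.YMGap.RobustBall.AreaLawRowsSU3PV2T
import HarnessLib

/-!
# Venture YMGap, track ROBUST-BALL (Y2) — `SU(3)` HYPOTHESIS-FREE ONE STATE for finite-range LOOP ACTIONS on the twisted-constant (PV2T)
# star cells (`ℤ⁴`)

HONEST FRAMING. WHAT THIS IS: a venture file (cell `pub-ymgap`, track Y2 ROBUST-BALL, seat engine-2 (g11); 0 compute).  ds-3's one-state composition
`oneState_onBallZdG` × rb-p1's membership lemma `memBallZdG_loopFamilyAction` (a finite-range loop action `S_W + Σ_i c_i Re tr U_{γ_i}/3` with finite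
carrier fibres, finitely many loops through every link, loops of extent `≤ R` and UNWEIGHTED loop norm `LoopNormLE 0 γ cpl η` lies in the gauge-invariant
tier-1 ball `MemBallZdG (2η) (4η) R`) applied to THIS SEAT's hypothesis-free `SU(3)` PV2T cells (twisted one-link Poincaré constant): the `ℤ⁴` star cell `su3_massGapOnBallZdG_pv2tStar_*` at
`(β_W, 2ε, ε)` shrunk to the loads `(ε/2, ε) = (2η, 4η)`, `η = ε/4`, × the PV2T pair-door area law `su3_areaLawOnBall_pv2t` at `(β_W, (2ε, ε))` restricted to the same loads.  For every range `R` ONE `(C, c)`, `c > 0`: unique DLR state = periodised-torus limit, massive, plaquette decay, `HasAreaLawWith μ χ₃ C c`.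
Class K outright.  CELLS `(β_W, η)`: (1/8, .0747) (1/6, .0645) (1/5, .056) (1/4, .0432) (3/10, .03) (1/3, .021) (17/50, .0192) (3/8, .0095) (2/5, .0025).
WHAT MOVES: g10's hypothesis-free `SU(3)` loop-action one-state cells `OneStateLoopsSU3PV2` (4f66980a76c6) were (1/8, .06725) … (17/50, .00275) (frontier `17/50`);
every cell here is larger and the frontier moves to `2/5`.  NOT CLAIMED: string-tension
existence for a loop action; range-uniform constants; anything about the continuum or the Millennium problem.

References: ds-3's `RobustBall/OneStateLoops.lean`, `OneState.lean`; rb-p1's `LoopActionGaugeBall.lean` (`memBallZdG_loopFamilyAction`);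
this seat's `StarRowsSU3PV2T.lean`, `AreaLawRowsSU3PV2T.lean`, `Thresholds/OneLinkModulusSU3Twisted.lean`; certificates `pv2t/cert_pv2t.json`.
-/

noncomputable section

open MeasureTheory Filter Topology Function Finset
open scoped NNReal
open Literature.Probability.LatticeModels
open Literature.MathematicalPhysics.QuantumLattice hiding torusNorm
open Literature.MathematicalPhysics.QuantumFieldTheory hiding ZdEdge Site
open Literature.MathematicalPhysics.QuantumFieldTheory (walkEdges)
open Literature.Barriers.QuantumFields (IsMassiveState)
open Summit.Ventures.YMGap.RobustBallPV (su3_areaLawOnBall_pv2t)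

namespace Summit.Ventures.YMGap.RobustBall

variable {ι : Type*}

/-- **`SU(3)`, `ℤ⁴`, `β_W = 1/8`, loop norm `‖c‖₀ ≤ .0747`, HYPOTHESIS-FREE**: for each range `R` one `(C, c)`, `c > 0`, such that EVERY finite-range
`SU(3)` loop action (finite carrier fibres, finitely many loops through every link, loops of extent `≤ R`, `LoopNormLE 0 γ cpl (299 / 4000)`) near Wilson
`β_W = 1/8` has ONE state: unique DLR state = periodised-torus limit, massive, plaquette decay, `HasAreaLawWith μ χ₃ C c`
(`su3_massGapOnBallZdG_pv2tStar_oneEighth` × the PV2T area law, loads shrunk to `(299 / 2000, 299 / 1000)`). [folklore] -/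
theorem su3_loops_oneState_pv2t_oneEighth (R : ℕ) :
    ∃ C c : ℝ, 0 < c ∧ ∀ (γ : ι → ZdLoop 4) (cpl : ι → ℝ),
      (∀ X, {i | walkEdges (γ i).walk = X}.Finite) → (∀ e : ZdEdge 4, {i | e ∈ walkEdges (γ i).walk}.Finite) →
      (∀ i, ∀ e ∈ walkEdges (γ i).walk, ∀ y ∈ walkEdges (γ i).walk, ‖e.1 - y.1‖ ≤ (R : ℝ)) →
      LoopNormLE 0 γ cpl (299 / 4000) →
      ∀ (hdep : ∀ X, DependsOn (loopFamilyAction (d := 4) 3 γ cpl X) (↑X : Set (ZdEdge 4)))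
        (hg : ∀ X, IsZdGaugeInvariant (loopFamilyAction (d := 4) 3 γ cpl X))
        (hm : ∀ X, Measurable (loopFamilyAction (d := 4) 3 γ cpl X))
        (hb : ∀ X, ∃ C, ∀ U, |loopFamilyAction (d := 4) 3 γ cpl X U| ≤ C),
      ∃ μ : Measure (LGConfig 4 (SUN 3)),
        perturbedGibbsMeasures (d := 4) (fundamentalRep (Fin 3)) (((3 : ℕ) : ℝ) * ((1 / 8 : ℝ) / 9))
            (loopFamilyAction (d := 4) 3 γ cpl) (loopSupp γ) = {μ} ∧
        perturbedLimitPoints (((3 : ℕ) : ℝ) * ((1 / 8 : ℝ) / 9))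
            (periodisedFamily (loopFamilyAction (d := 4) 3 γ cpl) (loopSupp γ) hdep hg hm hb) = {μ} ∧
        IsMassiveState μ ∧ HasExponentialDecay (plaquetteCorrFn (fundamentalRep (Fin 3)) μ) ∧
        HasAreaLawWith μ (fun g => normalisedCharacter 3 (fundamentalRep (Fin 3) g)) C c := by
  have hgap : MassGapOnBallZdG 4 3 ((1 / 8 : ℝ) / 9) (299 / 2000) (299 / 1000) R := by
    have h := (su3_massGapOnBallZdG_pv2tStar_oneEighth R).mono (ε₀' := 299 / 2000) (ε₁' := 299 / 1000)
      (by norm_num) (by norm_num) le_rfl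
    norm_num at h ⊢; exact h
  have hA0 : AreaLawOnBall 3 4 ((1 / 8 : ℝ) / 3) (2 * (299 / 1000)) (299 / 1000) R (2 * R + 1) :=
    su3_areaLawOnBall_pv2t (n := 3) R (mv := 2 * R + 1) (by omega) (βW := 1 / 8) (ε := 299 / 1000) (R := 1 / 12) (τ := 531 / 500)
      (Ks := 148251 / 100000) (s₀ := 401271 / 500000) (Kp := 6521 / 4200) (by norm_num) (by norm_num) (by norm_num) (by norm_num) (by norm_num) (by norm_num)
      (by norm_num) (by norm_num) (by norm_num) (by norm_num) (by norm_num) (by norm_num)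
  have hA : AreaLawOnBall 3 4 (((3 : ℕ) : ℝ) * ((1 / 8 : ℝ) / 9)) (299 / 2000) (299 / 1000) R (2 * R + 1) := by
    have e : ((3 : ℕ) : ℝ) * ((1 / 8 : ℝ) / 9) = (1 / 8 : ℝ) / 3 := by push_cast; ring
    rw [e]
    exact hA0.anti (by norm_num) (by norm_num) le_rfl le_rfl
  obtain ⟨C, c, hc, hA'⟩ := oneState_onBallZdG (N := 3) (β := (1 / 8 : ℝ) / 9) (by norm_num) (by norm_num) (by norm_num) hgap hA
  refine ⟨C, c, hc, fun γ cpl hfin hthr hR h hdep hg hm hb => hA' _ _ ?_ hdep hg hm hb⟩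
  have hmem := memBallZdG_loopFamilyAction (d := 4) (N := 3) hfin hthr hR h
  norm_num at hmem ⊢
  exact hmem

/-- **`SU(3)`, `ℤ⁴`, `β_W = 1/6`, loop norm `‖c‖₀ ≤ .0645`, HYPOTHESIS-FREE**: for each range `R` one `(C, c)`, `c > 0`, such that EVERY finite-range
`SU(3)` loop action (finite carrier fibres, finitely many loops through every link, loops of extent `≤ R`, `LoopNormLE 0 γ cpl (129 / 2000)`) near Wilson
`β_W = 1/6` has ONE state: unique DLR state = periodised-torus limit, massive, plaquette decay, `HasAreaLawWith μ χ₃ C c`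
(`su3_massGapOnBallZdG_pv2tStar_oneSixth` × the PV2T area law, loads shrunk to `(129 / 1000, 129 / 500)`). [folklore] -/
theorem su3_loops_oneState_pv2t_oneSixth (R : ℕ) :
    ∃ C c : ℝ, 0 < c ∧ ∀ (γ : ι → ZdLoop 4) (cpl : ι → ℝ),
      (∀ X, {i | walkEdges (γ i).walk = X}.Finite) → (∀ e : ZdEdge 4, {i | e ∈ walkEdges (γ i).walk}.Finite) →
      (∀ i, ∀ e ∈ walkEdges (γ i).walk, ∀ y ∈ walkEdges (γ i).walk, ‖e.1 - y.1‖ ≤ (R : ℝ)) →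
      LoopNormLE 0 γ cpl (129 / 2000) →
      ∀ (hdep : ∀ X, DependsOn (loopFamilyAction (d := 4) 3 γ cpl X) (↑X : Set (ZdEdge 4)))
        (hg : ∀ X, IsZdGaugeInvariant (loopFamilyAction (d := 4) 3 γ cpl X))
        (hm : ∀ X, Measurable (loopFamilyAction (d := 4) 3 γ cpl X))
        (hb : ∀ X, ∃ C, ∀ U, |loopFamilyAction (d := 4) 3 γ cpl X U| ≤ C),
      ∃ μ : Measure (LGConfig 4 (SUN 3)),
        perturbedGibbsMeasures (d := 4) (fundamentalRep (Fin 3)) (((3 : ℕ) : ℝ) * ((1 / 6 : ℝ) / 9))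
            (loopFamilyAction (d := 4) 3 γ cpl) (loopSupp γ) = {μ} ∧
        perturbedLimitPoints (((3 : ℕ) : ℝ) * ((1 / 6 : ℝ) / 9))
            (periodisedFamily (loopFamilyAction (d := 4) 3 γ cpl) (loopSupp γ) hdep hg hm hb) = {μ} ∧
        IsMassiveState μ ∧ HasExponentialDecay (plaquetteCorrFn (fundamentalRep (Fin 3)) μ) ∧
        HasAreaLawWith μ (fun g => normalisedCharacter 3 (fundamentalRep (Fin 3) g)) C c := by
  have hgap : MassGapOnBallZdG 4 3 ((1 / 6 : ℝ) / 9) (129 / 1000) (129 / 500) R := by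
    have h := (su3_massGapOnBallZdG_pv2tStar_oneSixth R).mono (ε₀' := 129 / 1000) (ε₁' := 129 / 500)
      (by norm_num) (by norm_num) le_rfl
    norm_num at h ⊢; exact h
  have hA0 : AreaLawOnBall 3 4 ((1 / 6 : ℝ) / 3) (2 * (129 / 500)) (129 / 500) R (2 * R + 1) :=
    su3_areaLawOnBall_pv2t (n := 3) R (mv := 2 * R + 1) (by omega) (βW := 1 / 6) (ε := 129 / 500) (R := 1 / 9) (τ := 541 / 500)
      (Ks := 154291 / 100000) (s₀ := 816843 / 1000000) (Kp := 4721 / 3150) (by norm_num) (by norm_num) (by norm_num) (by norm_num) (by norm_num) (by norm_num)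
      (by norm_num) (by norm_num) (by norm_num) (by norm_num) (by norm_num) (by norm_num)
  have hA : AreaLawOnBall 3 4 (((3 : ℕ) : ℝ) * ((1 / 6 : ℝ) / 9)) (129 / 1000) (129 / 500) R (2 * R + 1) := by
    have e : ((3 : ℕ) : ℝ) * ((1 / 6 : ℝ) / 9) = (1 / 6 : ℝ) / 3 := by push_cast; ring
    rw [e]
    exact hA0.anti (by norm_num) (by norm_num) le_rfl le_rfl
  obtain ⟨C, c, hc, hA'⟩ := oneState_onBallZdG (N := 3) (β := (1 / 6 : ℝ) / 9) (by norm_num) (by norm_num) (by norm_num) hgap hA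
  refine ⟨C, c, hc, fun γ cpl hfin hthr hR h hdep hg hm hb => hA' _ _ ?_ hdep hg hm hb⟩
  have hmem := memBallZdG_loopFamilyAction (d := 4) (N := 3) hfin hthr hR h
  norm_num at hmem ⊢
  exact hmem

/-- **`SU(3)`, `ℤ⁴`, `β_W = 1/5`, loop norm `‖c‖₀ ≤ .056`, HYPOTHESIS-FREE**: for each range `R` one `(C, c)`, `c > 0`, such that EVERY finite-range
`SU(3)` loop action (finite carrier fibres, finitely many loops through every link, loops of extent `≤ R`, `LoopNormLE 0 γ cpl (7 / 125)`) near Wilson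
`β_W = 1/5` has ONE state: unique DLR state = periodised-torus limit, massive, plaquette decay, `HasAreaLawWith μ χ₃ C c`
(`su3_massGapOnBallZdG_pv2tStar_oneFifth` × the PV2T area law, loads shrunk to `(14 / 125, 28 / 125)`). [folklore] -/
theorem su3_loops_oneState_pv2t_oneFifth (R : ℕ) :
    ∃ C c : ℝ, 0 < c ∧ ∀ (γ : ι → ZdLoop 4) (cpl : ι → ℝ),
      (∀ X, {i | walkEdges (γ i).walk = X}.Finite) → (∀ e : ZdEdge 4, {i | e ∈ walkEdges (γ i).walk}.Finite) →
      (∀ i, ∀ e ∈ walkEdges (γ i).walk, ∀ y ∈ walkEdges (γ i).walk, ‖e.1 - y.1‖ ≤ (R : ℝ)) →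
      LoopNormLE 0 γ cpl (7 / 125) →
      ∀ (hdep : ∀ X, DependsOn (loopFamilyAction (d := 4) 3 γ cpl X) (↑X : Set (ZdEdge 4)))
        (hg : ∀ X, IsZdGaugeInvariant (loopFamilyAction (d := 4) 3 γ cpl X))
        (hm : ∀ X, Measurable (loopFamilyAction (d := 4) 3 γ cpl X))
        (hb : ∀ X, ∃ C, ∀ U, |loopFamilyAction (d := 4) 3 γ cpl X U| ≤ C),
      ∃ μ : Measure (LGConfig 4 (SUN 3)),
        perturbedGibbsMeasures (d := 4) (fundamentalRep (Fin 3)) (((3 : ℕ) : ℝ) * ((1 / 5 : ℝ) / 9))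
            (loopFamilyAction (d := 4) 3 γ cpl) (loopSupp γ) = {μ} ∧
        perturbedLimitPoints (((3 : ℕ) : ℝ) * ((1 / 5 : ℝ) / 9))
            (periodisedFamily (loopFamilyAction (d := 4) 3 γ cpl) (loopSupp γ) hdep hg hm hb) = {μ} ∧
        IsMassiveState μ ∧ HasExponentialDecay (plaquetteCorrFn (fundamentalRep (Fin 3)) μ) ∧
        HasAreaLawWith μ (fun g => normalisedCharacter 3 (fundamentalRep (Fin 3) g)) C c := by
  have hgap : MassGapOnBallZdG 4 3 ((1 / 5 : ℝ) / 9) (14 / 125) (28 / 125) R := by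
    have h := (su3_massGapOnBallZdG_pv2tStar_oneFifth R).mono (ε₀' := 14 / 125) (ε₁' := 28 / 125)
      (by norm_num) (by norm_num) le_rfl
    norm_num at h ⊢; exact h
  have hA0 : AreaLawOnBall 3 4 ((1 / 5 : ℝ) / 3) (2 * (28 / 125)) (28 / 125) R (2 * R + 1) :=
    su3_areaLawOnBall_pv2t (n := 3) R (mv := 2 * R + 1) (by omega) (βW := 1 / 5) (ε := 28 / 125) (R := 2 / 15) (τ := 549 / 500)
      (Ks := 19927 / 12500) (s₀ := 828851 / 1000000) (Kp := 3821 / 2625) (by norm_num) (by norm_num) (by norm_num) (by norm_num) (by norm_num) (by norm_num)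
      (by norm_num) (by norm_num) (by norm_num) (by norm_num) (by norm_num) (by norm_num)
  have hA : AreaLawOnBall 3 4 (((3 : ℕ) : ℝ) * ((1 / 5 : ℝ) / 9)) (14 / 125) (28 / 125) R (2 * R + 1) := by
    have e : ((3 : ℕ) : ℝ) * ((1 / 5 : ℝ) / 9) = (1 / 5 : ℝ) / 3 := by push_cast; ring
    rw [e]
    exact hA0.anti (by norm_num) (by norm_num) le_rfl le_rfl
  obtain ⟨C, c, hc, hA'⟩ := oneState_onBallZdG (N := 3) (β := (1 / 5 : ℝ) / 9) (by norm_num) (by norm_num) (by norm_num) hgap hA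
  refine ⟨C, c, hc, fun γ cpl hfin hthr hR h hdep hg hm hb => hA' _ _ ?_ hdep hg hm hb⟩
  have hmem := memBallZdG_loopFamilyAction (d := 4) (N := 3) hfin hthr hR h
  norm_num at hmem ⊢
  exact hmem

/-- **`SU(3)`, `ℤ⁴`, `β_W = 1/4`, loop norm `‖c‖₀ ≤ .0432`, HYPOTHESIS-FREE**: for each range `R` one `(C, c)`, `c > 0`, such that EVERY finite-range
`SU(3)` loop action (finite carrier fibres, finitely many loops through every link, loops of extent `≤ R`, `LoopNormLE 0 γ cpl (173 / 4000)`) near Wilson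
`β_W = 1/4` has ONE state: unique DLR state = periodised-torus limit, massive, plaquette decay, `HasAreaLawWith μ χ₃ C c`
(`su3_massGapOnBallZdG_pv2tStar_oneQuarter` × the PV2T area law, loads shrunk to `(173 / 2000, 173 / 1000)`). [folklore] -/
theorem su3_loops_oneState_pv2t_oneQuarter (R : ℕ) :
    ∃ C c : ℝ, 0 < c ∧ ∀ (γ : ι → ZdLoop 4) (cpl : ι → ℝ),
      (∀ X, {i | walkEdges (γ i).walk = X}.Finite) → (∀ e : ZdEdge 4, {i | e ∈ walkEdges (γ i).walk}.Finite) →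
      (∀ i, ∀ e ∈ walkEdges (γ i).walk, ∀ y ∈ walkEdges (γ i).walk, ‖e.1 - y.1‖ ≤ (R : ℝ)) →
      LoopNormLE 0 γ cpl (173 / 4000) →
      ∀ (hdep : ∀ X, DependsOn (loopFamilyAction (d := 4) 3 γ cpl X) (↑X : Set (ZdEdge 4)))
        (hg : ∀ X, IsZdGaugeInvariant (loopFamilyAction (d := 4) 3 γ cpl X))
        (hm : ∀ X, Measurable (loopFamilyAction (d := 4) 3 γ cpl X))
        (hb : ∀ X, ∃ C, ∀ U, |loopFamilyAction (d := 4) 3 γ cpl X U| ≤ C),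
      ∃ μ : Measure (LGConfig 4 (SUN 3)),
        perturbedGibbsMeasures (d := 4) (fundamentalRep (Fin 3)) (((3 : ℕ) : ℝ) * ((1 / 4 : ℝ) / 9))
            (loopFamilyAction (d := 4) 3 γ cpl) (loopSupp γ) = {μ} ∧
        perturbedLimitPoints (((3 : ℕ) : ℝ) * ((1 / 4 : ℝ) / 9))
            (periodisedFamily (loopFamilyAction (d := 4) 3 γ cpl) (loopSupp γ) hdep hg hm hb) = {μ} ∧
        IsMassiveState μ ∧ HasExponentialDecay (plaquetteCorrFn (fundamentalRep (Fin 3)) μ) ∧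
        HasAreaLawWith μ (fun g => normalisedCharacter 3 (fundamentalRep (Fin 3) g)) C c := by
  have hgap : MassGapOnBallZdG 4 3 ((1 / 4 : ℝ) / 9) (173 / 2000) (173 / 1000) R := by
    have h := (su3_massGapOnBallZdG_pv2tStar_oneQuarter R).mono (ε₀' := 173 / 2000) (ε₁' := 173 / 1000)
      (by norm_num) (by norm_num) le_rfl
    norm_num at h ⊢; exact h
  have hA0 : AreaLawOnBall 3 4 ((1 / 4 : ℝ) / 3) (2 * (173 / 1000)) (173 / 1000) R (2 * R + 1) :=
    su3_areaLawOnBall_pv2t (n := 3) R (mv := 2 * R + 1) (by omega) (βW := 1 / 4) (ε := 173 / 1000) (R := 1 / 6) (τ := 561 / 500)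
      (Ks := 83817 / 50000) (s₀ := 847899 / 1000000) (Kp := 2921 / 2100) (by norm_num) (by norm_num) (by norm_num) (by norm_num) (by norm_num) (by norm_num)
      (by norm_num) (by norm_num) (by norm_num) (by norm_num) (by norm_num) (by norm_num)
  have hA : AreaLawOnBall 3 4 (((3 : ℕ) : ℝ) * ((1 / 4 : ℝ) / 9)) (173 / 2000) (173 / 1000) R (2 * R + 1) := by
    have e : ((3 : ℕ) : ℝ) * ((1 / 4 : ℝ) / 9) = (1 / 4 : ℝ) / 3 := by push_cast; ring
    rw [e]
    exact hA0.anti (by norm_num) (by norm_num) le_rfl le_rfl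
  obtain ⟨C, c, hc, hA'⟩ := oneState_onBallZdG (N := 3) (β := (1 / 4 : ℝ) / 9) (by norm_num) (by norm_num) (by norm_num) hgap hA
  refine ⟨C, c, hc, fun γ cpl hfin hthr hR h hdep hg hm hb => hA' _ _ ?_ hdep hg hm hb⟩
  have hmem := memBallZdG_loopFamilyAction (d := 4) (N := 3) hfin hthr hR h
  norm_num at hmem ⊢
  exact hmem

/-- **`SU(3)`, `ℤ⁴`, `β_W = 3/10`, loop norm `‖c‖₀ ≤ .03`, HYPOTHESIS-FREE**: for each range `R` one `(C, c)`, `c > 0`, such that EVERY finite-range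
`SU(3)` loop action (finite carrier fibres, finitely many loops through every link, loops of extent `≤ R`, `LoopNormLE 0 γ cpl (3 / 100)`) near Wilson
`β_W = 3/10` has ONE state: unique DLR state = periodised-torus limit, massive, plaquette decay, `HasAreaLawWith μ χ₃ C c`
(`su3_massGapOnBallZdG_pv2tStar_threeTenths` × the PV2T area law, loads shrunk to `(3 / 50, 3 / 25)`). [folklore] -/
theorem su3_loops_oneState_pv2t_threeTenths (R : ℕ) :
    ∃ C c : ℝ, 0 < c ∧ ∀ (γ : ι → ZdLoop 4) (cpl : ι → ℝ),
      (∀ X, {i | walkEdges (γ i).walk = X}.Finite) → (∀ e : ZdEdge 4, {i | e ∈ walkEdges (γ i).walk}.Finite) →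
      (∀ i, ∀ e ∈ walkEdges (γ i).walk, ∀ y ∈ walkEdges (γ i).walk, ‖e.1 - y.1‖ ≤ (R : ℝ)) →
      LoopNormLE 0 γ cpl (3 / 100) →
      ∀ (hdep : ∀ X, DependsOn (loopFamilyAction (d := 4) 3 γ cpl X) (↑X : Set (ZdEdge 4)))
        (hg : ∀ X, IsZdGaugeInvariant (loopFamilyAction (d := 4) 3 γ cpl X))
        (hm : ∀ X, Measurable (loopFamilyAction (d := 4) 3 γ cpl X))
        (hb : ∀ X, ∃ C, ∀ U, |loopFamilyAction (d := 4) 3 γ cpl X U| ≤ C),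
      ∃ μ : Measure (LGConfig 4 (SUN 3)),
        perturbedGibbsMeasures (d := 4) (fundamentalRep (Fin 3)) (((3 : ℕ) : ℝ) * ((3 / 10 : ℝ) / 9))
            (loopFamilyAction (d := 4) 3 γ cpl) (loopSupp γ) = {μ} ∧
        perturbedLimitPoints (((3 : ℕ) : ℝ) * ((3 / 10 : ℝ) / 9))
            (periodisedFamily (loopFamilyAction (d := 4) 3 γ cpl) (loopSupp γ) hdep hg hm hb) = {μ} ∧
        IsMassiveState μ ∧ HasExponentialDecay (plaquetteCorrFn (fundamentalRep (Fin 3)) μ) ∧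
        HasAreaLawWith μ (fun g => normalisedCharacter 3 (fundamentalRep (Fin 3) g)) C c := by
  have hgap : MassGapOnBallZdG 4 3 ((3 / 10 : ℝ) / 9) (3 / 50) (3 / 25) R := by
    have h := (su3_massGapOnBallZdG_pv2tStar_threeTenths R).mono (ε₀' := 3 / 50) (ε₁' := 3 / 25)
      (by norm_num) (by norm_num) le_rfl
    norm_num at h ⊢; exact h
  have hA0 : AreaLawOnBall 3 4 ((3 / 10 : ℝ) / 3) (2 * (3 / 25)) (3 / 25) R (2 * R + 1) :=
    su3_areaLawOnBall_pv2t (n := 3) R (mv := 2 * R + 1) (by omega) (βW := 3 / 10) (ε := 3 / 25) (R := 1 / 5) (τ := 143 / 125)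
      (Ks := 88273 / 50000) (s₀ := 217081 / 250000) (Kp := 2321 / 1750) (by norm_num) (by norm_num) (by norm_num) (by norm_num) (by norm_num) (by norm_num)
      (by norm_num) (by norm_num) (by norm_num) (by norm_num) (by norm_num) (by norm_num)
  have hA : AreaLawOnBall 3 4 (((3 : ℕ) : ℝ) * ((3 / 10 : ℝ) / 9)) (3 / 50) (3 / 25) R (2 * R + 1) := by
    have e : ((3 : ℕ) : ℝ) * ((3 / 10 : ℝ) / 9) = (3 / 10 : ℝ) / 3 := by push_cast; ring
    rw [e]
    exact hA0.anti (by norm_num) (by norm_num) le_rfl le_rfl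
  obtain ⟨C, c, hc, hA'⟩ := oneState_onBallZdG (N := 3) (β := (3 / 10 : ℝ) / 9) (by norm_num) (by norm_num) (by norm_num) hgap hA
  refine ⟨C, c, hc, fun γ cpl hfin hthr hR h hdep hg hm hb => hA' _ _ ?_ hdep hg hm hb⟩
  have hmem := memBallZdG_loopFamilyAction (d := 4) (N := 3) hfin hthr hR h
  norm_num at hmem ⊢
  exact hmem

/-- **`SU(3)`, `ℤ⁴`, `β_W = 1/3`, loop norm `‖c‖₀ ≤ .021`, HYPOTHESIS-FREE**: for each range `R` one `(C, c)`, `c > 0`, such that EVERY finite-range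
`SU(3)` loop action (finite carrier fibres, finitely many loops through every link, loops of extent `≤ R`, `LoopNormLE 0 γ cpl (21 / 1000)`) near Wilson
`β_W = 1/3` has ONE state: unique DLR state = periodised-torus limit, massive, plaquette decay, `HasAreaLawWith μ χ₃ C c`
(`su3_massGapOnBallZdG_pv2tStar_oneThird` × the PV2T area law, loads shrunk to `(21 / 500, 21 / 250)`). [folklore] -/
theorem su3_loops_oneState_pv2t_oneThird (R : ℕ) :
    ∃ C c : ℝ, 0 < c ∧ ∀ (γ : ι → ZdLoop 4) (cpl : ι → ℝ),
      (∀ X, {i | walkEdges (γ i).walk = X}.Finite) → (∀ e : ZdEdge 4, {i | e ∈ walkEdges (γ i).walk}.Finite) →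
      (∀ i, ∀ e ∈ walkEdges (γ i).walk, ∀ y ∈ walkEdges (γ i).walk, ‖e.1 - y.1‖ ≤ (R : ℝ)) →
      LoopNormLE 0 γ cpl (21 / 1000) →
      ∀ (hdep : ∀ X, DependsOn (loopFamilyAction (d := 4) 3 γ cpl X) (↑X : Set (ZdEdge 4)))
        (hg : ∀ X, IsZdGaugeInvariant (loopFamilyAction (d := 4) 3 γ cpl X))
        (hm : ∀ X, Measurable (loopFamilyAction (d := 4) 3 γ cpl X))
        (hb : ∀ X, ∃ C, ∀ U, |loopFamilyAction (d := 4) 3 γ cpl X U| ≤ C),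
      ∃ μ : Measure (LGConfig 4 (SUN 3)),
        perturbedGibbsMeasures (d := 4) (fundamentalRep (Fin 3)) (((3 : ℕ) : ℝ) * ((1 / 3 : ℝ) / 9))
            (loopFamilyAction (d := 4) 3 γ cpl) (loopSupp γ) = {μ} ∧
        perturbedLimitPoints (((3 : ℕ) : ℝ) * ((1 / 3 : ℝ) / 9))
            (periodisedFamily (loopFamilyAction (d := 4) 3 γ cpl) (loopSupp γ) hdep hg hm hb) = {μ} ∧
        IsMassiveState μ ∧ HasExponentialDecay (plaquetteCorrFn (fundamentalRep (Fin 3)) μ) ∧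
        HasAreaLawWith μ (fun g => normalisedCharacter 3 (fundamentalRep (Fin 3) g)) C c := by
  have hgap : MassGapOnBallZdG 4 3 ((1 / 3 : ℝ) / 9) (21 / 500) (21 / 250) R := by
    have h := (su3_massGapOnBallZdG_pv2tStar_oneThird R).mono (ε₀' := 21 / 500) (ε₁' := 21 / 250)
      (by norm_num) (by norm_num) le_rfl
    norm_num at h ⊢; exact h
  have hA0 : AreaLawOnBall 3 4 ((1 / 3 : ℝ) / 3) (2 * (21 / 250)) (21 / 250) R (2 * R + 1) :=
    su3_areaLawOnBall_pv2t (n := 3) R (mv := 2 * R + 1) (by omega) (βW := 1 / 3) (ε := 21 / 250) (R := 2 / 9) (τ := 29 / 25)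
      (Ks := 18291 / 10000) (s₀ := 88279 / 100000) (Kp := 2021 / 1575) (by norm_num) (by norm_num) (by norm_num) (by norm_num) (by norm_num) (by norm_num)
      (by norm_num) (by norm_num) (by norm_num) (by norm_num) (by norm_num) (by norm_num)
  have hA : AreaLawOnBall 3 4 (((3 : ℕ) : ℝ) * ((1 / 3 : ℝ) / 9)) (21 / 500) (21 / 250) R (2 * R + 1) := by
    have e : ((3 : ℕ) : ℝ) * ((1 / 3 : ℝ) / 9) = (1 / 3 : ℝ) / 3 := by push_cast; ring
    rw [e]
    exact hA0.anti (by norm_num) (by norm_num) le_rfl le_rfl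
  obtain ⟨C, c, hc, hA'⟩ := oneState_onBallZdG (N := 3) (β := (1 / 3 : ℝ) / 9) (by norm_num) (by norm_num) (by norm_num) hgap hA
  refine ⟨C, c, hc, fun γ cpl hfin hthr hR h hdep hg hm hb => hA' _ _ ?_ hdep hg hm hb⟩
  have hmem := memBallZdG_loopFamilyAction (d := 4) (N := 3) hfin hthr hR h
  norm_num at hmem ⊢
  exact hmem

/-- **`SU(3)`, `ℤ⁴`, `β_W = 17/50`, loop norm `‖c‖₀ ≤ .0192`, HYPOTHESIS-FREE**: for each range `R` one `(C, c)`, `c > 0`, such that EVERY finite-range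
`SU(3)` loop action (finite carrier fibres, finitely many loops through every link, loops of extent `≤ R`, `LoopNormLE 0 γ cpl (77 / 4000)`) near Wilson
`β_W = 17/50` has ONE state: unique DLR state = periodised-torus limit, massive, plaquette decay, `HasAreaLawWith μ χ₃ C c`
(`su3_massGapOnBallZdG_pv2tStar_seventeenFiftieths` × the PV2T area law, loads shrunk to `(77 / 2000, 77 / 1000)`). [folklore] -/
theorem su3_loops_oneState_pv2t_seventeenFiftieths (R : ℕ) :
    ∃ C c : ℝ, 0 < c ∧ ∀ (γ : ι → ZdLoop 4) (cpl : ι → ℝ),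
      (∀ X, {i | walkEdges (γ i).walk = X}.Finite) → (∀ e : ZdEdge 4, {i | e ∈ walkEdges (γ i).walk}.Finite) →
      (∀ i, ∀ e ∈ walkEdges (γ i).walk, ∀ y ∈ walkEdges (γ i).walk, ‖e.1 - y.1‖ ≤ (R : ℝ)) →
      LoopNormLE 0 γ cpl (77 / 4000) →
      ∀ (hdep : ∀ X, DependsOn (loopFamilyAction (d := 4) 3 γ cpl X) (↑X : Set (ZdEdge 4)))
        (hg : ∀ X, IsZdGaugeInvariant (loopFamilyAction (d := 4) 3 γ cpl X))
        (hm : ∀ X, Measurable (loopFamilyAction (d := 4) 3 γ cpl X))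
        (hb : ∀ X, ∃ C, ∀ U, |loopFamilyAction (d := 4) 3 γ cpl X U| ≤ C),
      ∃ μ : Measure (LGConfig 4 (SUN 3)),
        perturbedGibbsMeasures (d := 4) (fundamentalRep (Fin 3)) (((3 : ℕ) : ℝ) * ((17 / 50 : ℝ) / 9))
            (loopFamilyAction (d := 4) 3 γ cpl) (loopSupp γ) = {μ} ∧
        perturbedLimitPoints (((3 : ℕ) : ℝ) * ((17 / 50 : ℝ) / 9))
            (periodisedFamily (loopFamilyAction (d := 4) 3 γ cpl) (loopSupp γ) hdep hg hm hb) = {μ} ∧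
        IsMassiveState μ ∧ HasExponentialDecay (plaquetteCorrFn (fundamentalRep (Fin 3)) μ) ∧
        HasAreaLawWith μ (fun g => normalisedCharacter 3 (fundamentalRep (Fin 3) g)) C c := by
  have hgap : MassGapOnBallZdG 4 3 ((17 / 50 : ℝ) / 9) (77 / 2000) (77 / 1000) R := by
    have h := (su3_massGapOnBallZdG_pv2tStar_seventeenFiftieths R).mono (ε₀' := 77 / 2000) (ε₁' := 77 / 1000)
      (by norm_num) (by norm_num) le_rfl
    norm_num at h ⊢; exact h
  have hA0 : AreaLawOnBall 3 4 ((17 / 50 : ℝ) / 3) (2 * (77 / 1000)) (77 / 1000) R (2 * R + 1) :=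
    su3_areaLawOnBall_pv2t (n := 3) R (mv := 2 * R + 1) (by omega) (βW := 17 / 50) (ε := 77 / 1000) (R := 17 / 75) (τ := 581 / 500)
      (Ks := 92113 / 50000) (s₀ := 885771 / 1000000) (Kp := 33457 / 26250) (by norm_num) (by norm_num) (by norm_num) (by norm_num) (by norm_num) (by norm_num)
      (by norm_num) (by norm_num) (by norm_num) (by norm_num) (by norm_num) (by norm_num)
  have hA : AreaLawOnBall 3 4 (((3 : ℕ) : ℝ) * ((17 / 50 : ℝ) / 9)) (77 / 2000) (77 / 1000) R (2 * R + 1) := by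
    have e : ((3 : ℕ) : ℝ) * ((17 / 50 : ℝ) / 9) = (17 / 50 : ℝ) / 3 := by push_cast; ring
    rw [e]
    exact hA0.anti (by norm_num) (by norm_num) le_rfl le_rfl
  obtain ⟨C, c, hc, hA'⟩ := oneState_onBallZdG (N := 3) (β := (17 / 50 : ℝ) / 9) (by norm_num) (by norm_num) (by norm_num) hgap hA
  refine ⟨C, c, hc, fun γ cpl hfin hthr hR h hdep hg hm hb => hA' _ _ ?_ hdep hg hm hb⟩
  have hmem := memBallZdG_loopFamilyAction (d := 4) (N := 3) hfin hthr hR h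
  norm_num at hmem ⊢
  exact hmem

/-- **`SU(3)`, `ℤ⁴`, `β_W = 3/8`, loop norm `‖c‖₀ ≤ .0095`, HYPOTHESIS-FREE**: for each range `R` one `(C, c)`, `c > 0`, such that EVERY finite-range
`SU(3)` loop action (finite carrier fibres, finitely many loops through every link, loops of extent `≤ R`, `LoopNormLE 0 γ cpl (19 / 2000)`) near Wilson
`β_W = 3/8` has ONE state: unique DLR state = periodised-torus limit, massive, plaquette decay, `HasAreaLawWith μ χ₃ C c`
(`su3_massGapOnBallZdG_pv2tStar_threeEighths` × the PV2T area law, loads shrunk to `(19 / 1000, 19 / 500)`). [folklore] -/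
theorem su3_loops_oneState_pv2t_threeEighths (R : ℕ) :
    ∃ C c : ℝ, 0 < c ∧ ∀ (γ : ι → ZdLoop 4) (cpl : ι → ℝ),
      (∀ X, {i | walkEdges (γ i).walk = X}.Finite) → (∀ e : ZdEdge 4, {i | e ∈ walkEdges (γ i).walk}.Finite) →
      (∀ i, ∀ e ∈ walkEdges (γ i).walk, ∀ y ∈ walkEdges (γ i).walk, ‖e.1 - y.1‖ ≤ (R : ℝ)) →
      LoopNormLE 0 γ cpl (19 / 2000) →
      ∀ (hdep : ∀ X, DependsOn (loopFamilyAction (d := 4) 3 γ cpl X) (↑X : Set (ZdEdge 4)))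
        (hg : ∀ X, IsZdGaugeInvariant (loopFamilyAction (d := 4) 3 γ cpl X))
        (hm : ∀ X, Measurable (loopFamilyAction (d := 4) 3 γ cpl X))
        (hb : ∀ X, ∃ C, ∀ U, |loopFamilyAction (d := 4) 3 γ cpl X U| ≤ C),
      ∃ μ : Measure (LGConfig 4 (SUN 3)),
        perturbedGibbsMeasures (d := 4) (fundamentalRep (Fin 3)) (((3 : ℕ) : ℝ) * ((3 / 8 : ℝ) / 9))
            (loopFamilyAction (d := 4) 3 γ cpl) (loopSupp γ) = {μ} ∧
        perturbedLimitPoints (((3 : ℕ) : ℝ) * ((3 / 8 : ℝ) / 9))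
            (periodisedFamily (loopFamilyAction (d := 4) 3 γ cpl) (loopSupp γ) hdep hg hm hb) = {μ} ∧
        IsMassiveState μ ∧ HasExponentialDecay (plaquetteCorrFn (fundamentalRep (Fin 3)) μ) ∧
        HasAreaLawWith μ (fun g => normalisedCharacter 3 (fundamentalRep (Fin 3) g)) C c := by
  have hgap : MassGapOnBallZdG 4 3 ((3 / 8 : ℝ) / 9) (19 / 1000) (19 / 500) R := by
    have h := (su3_massGapOnBallZdG_pv2tStar_threeEighths R).mono (ε₀' := 19 / 1000) (ε₁' := 19 / 500)
      (by norm_num) (by norm_num) le_rfl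
    norm_num at h ⊢; exact h
  have hA0 : AreaLawOnBall 3 4 ((3 / 8 : ℝ) / 3) (2 * (19 / 500)) (19 / 500) R (2 * R + 1) :=
    su3_areaLawOnBall_pv2t (n := 3) R (mv := 2 * R + 1) (by omega) (βW := 3 / 8) (ε := 19 / 500) (R := 1 / 4) (τ := 589 / 500)
      (Ks := 23923 / 12500) (s₀ := 225483 / 250000) (Kp := 1721 / 1400) (by norm_num) (by norm_num) (by norm_num) (by norm_num) (by norm_num) (by norm_num)
      (by norm_num) (by norm_num) (by norm_num) (by norm_num) (by norm_num) (by norm_num)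
  have hA : AreaLawOnBall 3 4 (((3 : ℕ) : ℝ) * ((3 / 8 : ℝ) / 9)) (19 / 1000) (19 / 500) R (2 * R + 1) := by
    have e : ((3 : ℕ) : ℝ) * ((3 / 8 : ℝ) / 9) = (3 / 8 : ℝ) / 3 := by push_cast; ring
    rw [e]
    exact hA0.anti (by norm_num) (by norm_num) le_rfl le_rfl
  obtain ⟨C, c, hc, hA'⟩ := oneState_onBallZdG (N := 3) (β := (3 / 8 : ℝ) / 9) (by norm_num) (by norm_num) (by norm_num) hgap hA
  refine ⟨C, c, hc, fun γ cpl hfin hthr hR h hdep hg hm hb => hA' _ _ ?_ hdep hg hm hb⟩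
  have hmem := memBallZdG_loopFamilyAction (d := 4) (N := 3) hfin hthr hR h
  norm_num at hmem ⊢
  exact hmem

/-- **`SU(3)`, `ℤ⁴`, `β_W = 2/5`, loop norm `‖c‖₀ ≤ .0025`, HYPOTHESIS-FREE**: for each range `R` one `(C, c)`, `c > 0`, such that EVERY finite-range
`SU(3)` loop action (finite carrier fibres, finitely many loops through every link, loops of extent `≤ R`, `LoopNormLE 0 γ cpl (1 / 400)`) near Wilson
`β_W = 2/5` has ONE state: unique DLR state = periodised-torus limit, massive, plaquette decay, `HasAreaLawWith μ χ₃ C c`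
(`su3_massGapOnBallZdG_pv2tStar_twoFifths` × the PV2T area law, loads shrunk to `(1 / 200, 1 / 100)`). [folklore] -/
theorem su3_loops_oneState_pv2t_twoFifths (R : ℕ) :
    ∃ C c : ℝ, 0 < c ∧ ∀ (γ : ι → ZdLoop 4) (cpl : ι → ℝ),
      (∀ X, {i | walkEdges (γ i).walk = X}.Finite) → (∀ e : ZdEdge 4, {i | e ∈ walkEdges (γ i).walk}.Finite) →
      (∀ i, ∀ e ∈ walkEdges (γ i).walk, ∀ y ∈ walkEdges (γ i).walk, ‖e.1 - y.1‖ ≤ (R : ℝ)) →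
      LoopNormLE 0 γ cpl (1 / 400) →
      ∀ (hdep : ∀ X, DependsOn (loopFamilyAction (d := 4) 3 γ cpl X) (↑X : Set (ZdEdge 4)))
        (hg : ∀ X, IsZdGaugeInvariant (loopFamilyAction (d := 4) 3 γ cpl X))
        (hm : ∀ X, Measurable (loopFamilyAction (d := 4) 3 γ cpl X))
        (hb : ∀ X, ∃ C, ∀ U, |loopFamilyAction (d := 4) 3 γ cpl X U| ≤ C),
      ∃ μ : Measure (LGConfig 4 (SUN 3)),
        perturbedGibbsMeasures (d := 4) (fundamentalRep (Fin 3)) (((3 : ℕ) : ℝ) * ((2 / 5 : ℝ) / 9))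
            (loopFamilyAction (d := 4) 3 γ cpl) (loopSupp γ) = {μ} ∧
        perturbedLimitPoints (((3 : ℕ) : ℝ) * ((2 / 5 : ℝ) / 9))
            (periodisedFamily (loopFamilyAction (d := 4) 3 γ cpl) (loopSupp γ) hdep hg hm hb) = {μ} ∧
        IsMassiveState μ ∧ HasExponentialDecay (plaquetteCorrFn (fundamentalRep (Fin 3)) μ) ∧
        HasAreaLawWith μ (fun g => normalisedCharacter 3 (fundamentalRep (Fin 3) g)) C c := by
  have hgap : MassGapOnBallZdG 4 3 ((2 / 5 : ℝ) / 9) (1 / 200) (1 / 100) R := by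
    have h := (su3_massGapOnBallZdG_pv2tStar_twoFifths R).mono (ε₀' := 1 / 200) (ε₁' := 1 / 100)
      (by norm_num) (by norm_num) le_rfl
    norm_num at h ⊢; exact h
  have hA0 : AreaLawOnBall 3 4 ((2 / 5 : ℝ) / 3) (2 * (1 / 100)) (1 / 100) R (2 * R + 1) :=
    su3_areaLawOnBall_pv2t (n := 3) R (mv := 2 * R + 1) (by omega) (βW := 2 / 5) (ε := 1 / 100) (R := 4 / 15) (τ := 297 / 250)
      (Ks := 98383 / 50000) (s₀ := 914033 / 1000000) (Kp := 3142 / 2625) (by norm_num) (by norm_num) (by norm_num) (by norm_num) (by norm_num) (by norm_num)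
      (by norm_num) (by norm_num) (by norm_num) (by norm_num) (by norm_num) (by norm_num)
  have hA : AreaLawOnBall 3 4 (((3 : ℕ) : ℝ) * ((2 / 5 : ℝ) / 9)) (1 / 200) (1 / 100) R (2 * R + 1) := by
    have e : ((3 : ℕ) : ℝ) * ((2 / 5 : ℝ) / 9) = (2 / 5 : ℝ) / 3 := by push_cast; ring
    rw [e]
    exact hA0.anti (by norm_num) (by norm_num) le_rfl le_rfl
  obtain ⟨C, c, hc, hA'⟩ := oneState_onBallZdG (N := 3) (β := (2 / 5 : ℝ) / 9) (by norm_num) (by norm_num) (by norm_num) hgap hA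
  refine ⟨C, c, hc, fun γ cpl hfin hthr hR h hdep hg hm hb => hA' _ _ ?_ hdep hg hm hb⟩
  have hmem := memBallZdG_loopFamilyAction (d := 4) (N := 3) hfin hthr hR h
  norm_num at hmem ⊢
  exact hmem

end Summit.Ventures.YMGap.RobustBall

end
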